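import Summits.AnomalousDissipation.AnomalousDissipation.Theses.NeutralTaylorWaves
import Literature.Analysis.FluidPDE.LinearizedNSTorus
import Literature.Analysis.FunctionSpaces.TorusTrigPoly

/-!
# Crux `NewtonRealisation` (stmt-AnomalousDissipation-16315) — crux-ideate round 1, ideator 1: first lemmas

Sketch file of the two crux idea cards filed by `planner-cruxidea-stmt-AnomalousDissipation-16315-1-0`
(2026-08-17).  Statements only (`def … : Prop`), typed over existing declarations; nothing is proved
here and nothing is registered (no `stub_*`, no `NewtonRealisation_of`).  The two typed objects are

* `QuantBorderedPersistence` — first lemma of card `force-side-persistence` (the TRANSFER `C⁺`: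
  quantitative, bordered version of the in-tree conserved-mean steady implicit-function theorem
  `Literature.Analysis.FluidPDE.SteadyLatticeDrift.steadyPersistsInLeaf_of_nondeg`, with the
  Kantorovich radius made explicit and the nondegeneracy hypothesis replaced by the crux's bordered
  `L²` a-priori bound);
* `GalerkinInfSupInheritance` — first lemma of card `galerkin-infsup-limit` (the crux's bordered
  `L²` a-priori bound survives Fourier truncation `Torus.fourierTruncate N` with constant `3M` once
  `N ≥ poly(M, C, ν⁻¹)`: the discrete inf-sup constant of Brezzi–Rappaz–Raviart is INHERITED).

Both use the abbreviation `BorderedBound ν M w c` = the a-priori clause of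
`Theses.NeutralTaylorWaves.NonresonantTaylorWaves` at a single state, with constant `M`
(in the crux `M = C₀ ν^{-K₀}`).

PROVED here (no `sorry`, axioms `propext/Classical.choice/Quot.sound`): the force-side COMPOSITION
`NewtonRealisation_of_quantPersistence : QuantBorderedPersistence → CalculusFacts → DriftAbsorption →
Theses.NeutralTaylorWaves.NewtonRealisation` (the crux BY NAME), via the per-viscosity step `perStep` and the
power-counting lemma `persistenceConstant_mul_pow_le`; `CalculusFacts` = two elementary torus-calculus facts
(mean-zero full left-hand side; Minkowski for `‖∇·‖₂` + energy splitting), `DriftAbsorption` = the registered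
signature of `Lines/birth.lean`'s `stub_driftAbsorption` verbatim.
-/

set_option linter.dupNamespace false

noncomputable section

open Filter Set MeasureTheory Topology
open Literature.Analysis.FunctionSpaces Literature.Analysis.FunctionSpaces.Torus

namespace Summit.AnomalousDissipation.AnomalousDissipation.Cruxes.NewtonRealisation.Ideator1

/-- The flat unit three-torus (local notation). -/
local notation "𝕋³" => UnitAddTorus (Fin 3)
/-- Velocity values (local notation). -/
local notation "E³" => EuclideanSpace ℝ (Fin 3)

/-- The crux's bordered `L²` a-priori bound at ONE state `(w, c)` with viscosity `ν` and constant `M`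
(verbatim the last clause of `NonresonantTaylorWaves`, with `C₀ (ν n)⁻¹ ^ K₀` renamed `M`):
for all smooth mean-zero divergence-free `v`, smooth `r`, real `b`,
`∫‖v‖² + b² ≤ M² (‖w·∇v + v·∇w − νΔv + ∇r − c∂₃v − b∂₃w‖²₂ + ⟨v, ∂₃w⟩²)`. -/
def BorderedBound (ν M : ℝ) (w : 𝕋³ → E³) (c : ℝ) : Prop :=
  ∀ (v : 𝕋³ → E³) (r : 𝕋³ → ℝ) (b : ℝ), IsSmooth v → IsSmooth r → IsDivFree v → HasZeroMean v →
    MeasureTheory.integral MeasureTheory.volume (fun x => ‖v x‖ ^ 2) + b ^ 2 ≤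
      M ^ 2 * (MeasureTheory.integral MeasureTheory.volume (fun x =>
        ‖Torus.convect w v x + Torus.convect v w x - ν • Torus.laplacian v x + Torus.gradient r x -
          c • Torus.partialDeriv (2 : Fin 3) v x - b • Torus.partialDeriv (2 : Fin 3) w x‖ ^ 2) +
        (MeasureTheory.integral MeasureTheory.volume (fun x =>
          inner ℝ (v x) (Torus.partialDeriv (2 : Fin 3) w x))) ^ 2)

/-- **Card `force-side-persistence`, first lemma / transfer `C⁺`: QUANTITATIVE BORDERED PERSISTENCE OF
DRIFTED STEADY STATES UNDER A CHANGE OF FORCE (fixed viscosity).**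
There are universal `k : ℕ`, `A > 0` such that: if `(u₀, p₀, c)` is an EXACT smooth divergence-free
mean-zero drifted steady state of the smooth mean-zero force `f₀`,
`u₀·∇u₀ − νΔu₀ + ∇p₀ − c∂₃u₀ = f₀` (`0 < ν ≤ 1`), with `|c|, |u₀| ≤ C`, `|∇u₀| ≤ Cν⁻¹` and the
bordered `L²` a-priori bound with constant `M`, then EVERY smooth divergence-free mean-zero force `f`
with `‖f − f₀‖²₂ ≤ P⁻⁴`, `P := A(1+M)^k(1+C)^k ν^{-k}`, is realised by an exact smooth drifted steady
state `(u, p, c')`, `u·∇u − νΔu + ∇p − c'∂₃u = f`, with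
`‖u − u₀‖²₂ + ‖∇(u − u₀)‖²₂ + (c' − c)² ≤ P² ‖f − f₀‖²₂`.
(In the crux: `u₀ := w`, `f₀ := f + R` with `R` the pointwise residual, `‖R‖²₂ ≤ C_K ν^K < P⁻⁴` for
`K > 4k(K₀+1)` and `n` large; the drift is then absorbed into the mean, `u − c'e₃`.)
Intended proof: the conserved-mean lattice frame of `SteadyLatticeDrift` (state space `W`, bilinear
`B`, compact drift multiplier `D`, Fredholm alternative), bordered by `(b, ⟨·, ∂₃u₀⟩)`; injectivity and
the `W`-norm inverse bound `≤ P` from `BorderedBound` by Parseval + one elliptic step; the zero by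
`Literature.Analysis.Calculus.exists_zero_near_of_simplifiedNewton` (Lipschitz constant of the
derivative `2‖B‖ + 2‖D_{e₃}‖`, `ν`-free in the `W`-norm); rapid decay and synthesis by
`SteadyLatticeDrift.rapidDecay_of_perturbed_eq` / `steadyState_of_fourier'`. -/
def QuantBorderedPersistence : Prop :=
  ∃ (k : ℕ) (A : ℝ), 0 < A ∧ ∀ (ν C M : ℝ) (f₀ f u₀ : 𝕋³ → E³) (p₀ : 𝕋³ → ℝ) (c : ℝ),
    0 < ν → ν ≤ 1 → 0 ≤ C → 0 ≤ M →
    IsSmooth f₀ → HasZeroMean f₀ → IsSmooth f → IsDivFree f → HasZeroMean f →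
    IsSmooth u₀ → IsSmooth p₀ → IsDivFree u₀ → HasZeroMean u₀ → |c| ≤ C → (∀ x, ‖u₀ x‖ ≤ C) →
    (∀ (i : Fin 3) x, ‖Torus.partialDeriv i u₀ x‖ ≤ C * ν⁻¹) →
    (∀ x, Torus.convect u₀ u₀ x - ν • Torus.laplacian u₀ x + Torus.gradient p₀ x -
        c • Torus.partialDeriv (2 : Fin 3) u₀ x = f₀ x) →
    BorderedBound ν M u₀ c →
    MeasureTheory.integral MeasureTheory.volume (fun x => ‖f x - f₀ x‖ ^ 2) ≤
      ((A * (1 + M) ^ k * (1 + C) ^ k * ν⁻¹ ^ k) ^ 4)⁻¹ →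
    ∃ (u : 𝕋³ → E³) (p : 𝕋³ → ℝ) (c' : ℝ), IsSmooth u ∧ IsSmooth p ∧ IsDivFree u ∧ HasZeroMean u ∧
      (∀ x, Torus.convect u u x - ν • Torus.laplacian u x + Torus.gradient p x -
          c' • Torus.partialDeriv (2 : Fin 3) u x = f x) ∧
      MeasureTheory.integral MeasureTheory.volume (fun x => ‖u x - u₀ x‖ ^ 2) +
          gradNormSq (fun x => u x - u₀ x) + (c' - c) ^ 2 ≤
        (A * (1 + M) ^ k * (1 + C) ^ k * ν⁻¹ ^ k) ^ 2 *
          MeasureTheory.integral MeasureTheory.volume (fun x => ‖f x - f₀ x‖ ^ 2)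

/-- **Card `galerkin-infsup-limit`, first lemma: THE BORDERED A-PRIORI BOUND IS INHERITED BY THE
FOURIER–GALERKIN SPACES** (discrete inf-sup constant `3M` for `N ≥ poly(M, C, ν⁻¹)`).
There are universal `k : ℕ`, `A > 0` such that for every state `(w, c)` carrying the crux's sup bounds
(`|c|, |w| ≤ C`, `|∂w| ≤ Cν⁻¹`, `|∂∂w| ≤ Cν⁻²`) and `BorderedBound ν M w c`, and every truncation
order `N ≥ A(1+M)^k(1+C)^kν^{-k}`: for all band-limited (`Torus.fourierTruncate N v = v`)
divergence-free mean-zero `v`, smooth `r`, real `b`,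
`∫‖v‖² + b² ≤ (3M)² (‖P_N[w·∇v + v·∇w − νΔv − c∂₃v − b∂₃w] + ∇r‖²₂ + ⟨v, ∂₃w⟩²)`.
Why true: trigonometric polynomials are smooth, so `BorderedBound` applies to `v` verbatim; the
truncation defect `(1 − P_N)P[w·∇v + v·∇w − b∂₃w]` is a tail of an `H¹` field
(`4π²(N²+1)‖(1−P_N)a‖² ≤ ‖∇a‖²`, tree `integral_norm_sq_fourierTruncate_sub_le_gradNormSq`) whose
`H¹` norm is `≤ poly(C, ν⁻¹)(‖P_N-part‖ + ‖v‖ + |b|)` by one elliptic step (`‖Δv‖` read off the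
Stokes–Oseen symbol `4π²ν|k|² − 2πick₃`, `‖∇v‖² ≤ ‖v‖‖Δv‖`); for `N` beyond the threshold the defect
is absorbed.  This is the `N`-UNIFORM discrete inf-sup constant of Brezzi–Rappaz–Raviart
(doi:10.1007/bf01395985, Thm. 3) for the bordered linearisation, after which
`Literature.Analysis.Calculus.exists_zero_of_infSup_newton` runs in `V_N × ℝ` with `N`-uniform
constants and the exact state is the `N → ∞` limit. -/
def GalerkinInfSupInheritance : Prop :=
  ∃ (k : ℕ) (A : ℝ), 0 < A ∧ ∀ (ν C M : ℝ) (w : 𝕋³ → E³) (c : ℝ) (N : ℕ),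
    0 < ν → ν ≤ 1 → 0 ≤ C → 0 ≤ M →
    IsSmooth w → IsDivFree w → HasZeroMean w → |c| ≤ C → (∀ x, ‖w x‖ ≤ C) →
    (∀ (i : Fin 3) x, ‖Torus.partialDeriv i w x‖ ≤ C * ν⁻¹) →
    (∀ (i j : Fin 3) x, ‖Torus.partialDeriv i (Torus.partialDeriv j w) x‖ ≤ C * ν⁻¹ ^ 2) →
    BorderedBound ν M w c →
    A * (1 + M) ^ k * (1 + C) ^ k * ν⁻¹ ^ k ≤ (N : ℝ) →
    ∀ (v : 𝕋³ → E³) (r : 𝕋³ → ℝ) (b : ℝ), Torus.fourierTruncate N v = v → IsSmooth r →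
      IsDivFree v → HasZeroMean v →
      MeasureTheory.integral MeasureTheory.volume (fun x => ‖v x‖ ^ 2) + b ^ 2 ≤
        (3 * M) ^ 2 * (MeasureTheory.integral MeasureTheory.volume (fun x =>
          ‖Torus.fourierTruncate N (fun y => Torus.convect w v y + Torus.convect v w y -
                ν • Torus.laplacian v y - c • Torus.partialDeriv (2 : Fin 3) v y -
                b • Torus.partialDeriv (2 : Fin 3) w y) x + Torus.gradient r x‖ ^ 2) +
          (MeasureTheory.integral MeasureTheory.volume (fun x =>
            inner ℝ (v x) (Torus.partialDeriv (2 : Fin 3) w x))) ^ 2)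

/-- Bookkeeping sanity (the two quantitative objects are about the same clause): the crux's a-priori
hypothesis at a selected `n` is `BorderedBound (ν n) (C₀ * (ν n)⁻¹ ^ K₀) w c`, definitionally. -/
example (ν C₀ : ℝ) (K₀ : ℕ) (w : 𝕋³ → E³) (c : ℝ)
    (h : ∀ (v : 𝕋³ → E³) (r : 𝕋³ → ℝ) (b : ℝ), IsSmooth v → IsSmooth r → IsDivFree v → HasZeroMean v →
      MeasureTheory.integral MeasureTheory.volume (fun x => ‖v x‖ ^ 2) + b ^ 2 ≤
        (C₀ * ν⁻¹ ^ K₀) ^ 2 * (MeasureTheory.integral MeasureTheory.volume (fun x =>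
          ‖Torus.convect w v x + Torus.convect v w x - ν • Torus.laplacian v x + Torus.gradient r x -
            c • Torus.partialDeriv (2 : Fin 3) v x - b • Torus.partialDeriv (2 : Fin 3) w x‖ ^ 2) +
          (MeasureTheory.integral MeasureTheory.volume (fun x =>
            inner ℝ (v x) (Torus.partialDeriv (2 : Fin 3) w x))) ^ 2)) :
    BorderedBound ν (C₀ * ν⁻¹ ^ K₀) w c := h

/-- The steady-state predicate the crux's conclusion is made of: a time-constant classical solution is
`Literature.Analysis.FluidPDE.Torus.IsSteadyNSState` (definitionally `IsClassicalNSSolutionOn univ` on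
constant data) — the output format of `SteadyLatticeDrift.steadyState_of_fourier'`, which is why the
force-side line lands on the crux's conclusion with the drift already absorbed into the mean. -/
example (ν : ℝ) (f u : 𝕋³ → E³) (p : 𝕋³ → ℝ) :
    Literature.Analysis.FluidPDE.Torus.IsSteadyNSState ν f u p ↔
      IsClassicalNSSolutionOn Set.univ ν (fun _ => f) (fun _ => u) (fun _ => p) := Iff.rfl


/-! ## The force-side composition, kernel-checked: `C⁺ → (calculus facts) → (drift absorption) → NewtonRealisation`

Evidence that the transfer of card `force-side-persistence` CLOSES THE CRUX BY NAME: given `QuantBorderedPersistence`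
(C⁺), a package of elementary torus-calculus facts (each provable now from tree lemmas) and the registered line's
`stub_driftAbsorption` statement verbatim, the crux `Theses.NeutralTaylorWaves.NewtonRealisation` follows by selection along
the nonresonant subsequence and explicit power-counting (`K := 4k(K₀+1) + 3`).  No `sorry`; not a registered skeleton
(crux-ideate files no skeleton) — the crux-plan seat may lift it verbatim. -/

/-- Elementary calculus facts consumed by the composition (all provable now; packaged as one hypothesis so that the
composition is pure logic and arithmetic): (i) the full left-hand side `w·∇w − νΔw + ∇q − c∂₃w` of a smooth
divergence-free `w` and smooth `q` is smooth and MEAN-ZERO (each term integrates to zero on `T³`); (ii) Minkowski for the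
gradient seminorm, `‖∇v‖₂ ≤ ‖∇u‖₂ + ‖∇(u − v)‖₂`, and the energy splitting `∫‖u‖² ≤ 2∫‖v‖² + 2∫‖u − v‖²`, for smooth fields. -/
def CalculusFacts : Prop :=
  (∀ (ν : ℝ) (w : 𝕋³ → E³) (q : 𝕋³ → ℝ) (c : ℝ), IsSmooth w → IsDivFree w → IsSmooth q →
      IsSmooth (fun x => Torus.convect w w x - ν • Torus.laplacian w x + Torus.gradient q x -
          c • Torus.partialDeriv (2 : Fin 3) w x) ∧
        HasZeroMean (fun x => Torus.convect w w x - ν • Torus.laplacian w x + Torus.gradient q x -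
          c • Torus.partialDeriv (2 : Fin 3) w x)) ∧
  (∀ (u v : 𝕋³ → E³), IsSmooth u → IsSmooth v →
      Real.sqrt (gradNormSq v) ≤ Real.sqrt (gradNormSq u) + Real.sqrt (gradNormSq (fun x => u x - v x)) ∧
      MeasureTheory.integral MeasureTheory.volume (fun x => ‖u x‖ ^ 2) ≤
        2 * MeasureTheory.integral MeasureTheory.volume (fun x => ‖v x‖ ^ 2) +
          2 * MeasureTheory.integral MeasureTheory.volume (fun x => ‖u x - v x‖ ^ 2))

/-- Drift absorption — VERBATIM the registered signature of `stub_driftAbsorption` of `Lines/birth.lean` (so that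
landing birth's stub 3 discharges this hypothesis too): a smooth drifting steady state `(W, Q, c')` of force `f` gives the
time-constant classical solution `W − c'e₃` of `NS_ν(f)` with the same gradient norm and energy `∫‖W‖² + c'²`. -/
def DriftAbsorption : Prop :=
  ∀ (ν : ℝ) (f W : 𝕋³ → E³) (Q : 𝕋³ → ℝ) (c' : ℝ), IsSmooth W → IsSmooth Q → IsDivFree W →
    HasZeroMean W →
    (∀ x, Torus.convect W W x - ν • Torus.laplacian W x + Torus.gradient Q x -
        c' • Torus.partialDeriv (2 : Fin 3) W x = f x) →
    IsClassicalNSSolutionOn Set.univ ν (fun _ => f)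
        (fun _ x => W x - c' • EuclideanSpace.single (2 : Fin 3) (1 : ℝ)) (fun _ => Q) ∧
      gradNormSq (fun x => W x - c' • EuclideanSpace.single (2 : Fin 3) (1 : ℝ)) = gradNormSq W ∧
      MeasureTheory.integral MeasureTheory.volume
          (fun x => ‖W x - c' • EuclideanSpace.single (2 : Fin 3) (1 : ℝ)‖ ^ 2) =
        MeasureTheory.integral MeasureTheory.volume (fun x => ‖W x‖ ^ 2) + c' ^ 2

/-- Power-counting lemma (the only asymptotics in the composition): with `m = k(K₀+1)`,
`A(1 + |C₀|ν^{-K₀})^k(1+C)^kν^{-k} · ν^m ≤ A(1+|C₀|)^k(1+C)^k` for `0 < ν ≤ 1`. -/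
theorem persistenceConstant_mul_pow_le {A C C₀ ν : ℝ} {k K₀ : ℕ} (hA : 0 ≤ A) (hC : 0 ≤ C)
    (hν : 0 < ν) (hν1 : ν ≤ 1) :
    A * (1 + |C₀| * ν⁻¹ ^ K₀) ^ k * (1 + C) ^ k * ν⁻¹ ^ k * ν ^ (k * (K₀ + 1)) ≤
      A * (1 + |C₀|) ^ k * (1 + C) ^ k := by
  have hν0 : ν ≠ 0 := hν.ne'
  have hbase : (1 + |C₀| * ν⁻¹ ^ K₀) * ν⁻¹ * ν ^ (K₀ + 1) = ν ^ K₀ + |C₀| := by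
    have h1 : ν⁻¹ ^ K₀ * ν ^ K₀ = 1 := by rw [← mul_pow, inv_mul_cancel₀ hν0, one_pow]
    have h2 : ν⁻¹ * ν = 1 := inv_mul_cancel₀ hν0
    calc (1 + |C₀| * ν⁻¹ ^ K₀) * ν⁻¹ * ν ^ (K₀ + 1)
        = (ν ^ K₀ + |C₀| * (ν⁻¹ ^ K₀ * ν ^ K₀)) * (ν⁻¹ * ν) := by rw [pow_succ]; ring
      _ = ν ^ K₀ + |C₀| := by rw [h1, h2]; ring
  have hpow : ν ^ (k * (K₀ + 1)) = (ν ^ (K₀ + 1)) ^ k := by rw [mul_comm, pow_mul]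
  have hle : ν ^ K₀ + |C₀| ≤ 1 + |C₀| := by
    have : ν ^ K₀ ≤ 1 := pow_le_one₀ hν.le hν1
    linarith
  have hnn : 0 ≤ ν ^ K₀ + |C₀| := by positivity
  calc A * (1 + |C₀| * ν⁻¹ ^ K₀) ^ k * (1 + C) ^ k * ν⁻¹ ^ k * ν ^ (k * (K₀ + 1))
      = A * (1 + C) ^ k * ((1 + |C₀| * ν⁻¹ ^ K₀) * ν⁻¹ * ν ^ (K₀ + 1)) ^ k := by
        rw [hpow, mul_pow, mul_pow]; ring
    _ = A * (1 + C) ^ k * (ν ^ K₀ + |C₀|) ^ k := by rw [hbase]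
    _ ≤ A * (1 + C) ^ k * (1 + |C₀|) ^ k := by
        gcongr
    _ = A * (1 + |C₀|) ^ k * (1 + C) ^ k := by ring

set_option maxHeartbeats 1600000 in
/-- **The per-viscosity step of the force-side composition** (one selected `n`; all thresholds as hypotheses):
from C⁺ (with its constants `k, A`), the calculus facts, drift absorption and the crux's data at ONE state — an order
`K = 4k(K₀+1)+3` quasi-steady state `(w, q, c)` at viscosity `ν` below the five thresholds — produce the classical steady
solution with energy `≤ 2E + 2 + (C''+1)²` and dissipation `≥ ε₀/2`. -/
theorem perStep {k : ℕ} {A : ℝ}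
    (hP : ∀ (ν C M : ℝ) (f₀ f u₀ : 𝕋³ → E³) (p₀ : 𝕋³ → ℝ) (c : ℝ),
      0 < ν → ν ≤ 1 → 0 ≤ C → 0 ≤ M →
      IsSmooth f₀ → HasZeroMean f₀ → IsSmooth f → IsDivFree f → HasZeroMean f →
      IsSmooth u₀ → IsSmooth p₀ → IsDivFree u₀ → HasZeroMean u₀ → |c| ≤ C → (∀ x, ‖u₀ x‖ ≤ C) →
      (∀ (i : Fin 3) x, ‖Torus.partialDeriv i u₀ x‖ ≤ C * ν⁻¹) →
      (∀ x, Torus.convect u₀ u₀ x - ν • Torus.laplacian u₀ x + Torus.gradient p₀ x -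
          c • Torus.partialDeriv (2 : Fin 3) u₀ x = f₀ x) →
      BorderedBound ν M u₀ c →
      MeasureTheory.integral MeasureTheory.volume (fun x => ‖f x - f₀ x‖ ^ 2) ≤
        ((A * (1 + M) ^ k * (1 + C) ^ k * ν⁻¹ ^ k) ^ 4)⁻¹ →
      ∃ (u : 𝕋³ → E³) (p : 𝕋³ → ℝ) (c' : ℝ), IsSmooth u ∧ IsSmooth p ∧ IsDivFree u ∧ HasZeroMean u ∧
        (∀ x, Torus.convect u u x - ν • Torus.laplacian u x + Torus.gradient p x -
            c' • Torus.partialDeriv (2 : Fin 3) u x = f x) ∧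
        MeasureTheory.integral MeasureTheory.volume (fun x => ‖u x - u₀ x‖ ^ 2) +
            gradNormSq (fun x => u x - u₀ x) + (c' - c) ^ 2 ≤
          (A * (1 + M) ^ k * (1 + C) ^ k * ν⁻¹ ^ k) ^ 2 *
            MeasureTheory.integral MeasureTheory.volume (fun x => ‖f x - f₀ x‖ ^ 2))
    (hF1 : ∀ (ν : ℝ) (w : 𝕋³ → E³) (q : 𝕋³ → ℝ) (c : ℝ), IsSmooth w → IsDivFree w → IsSmooth q →
      IsSmooth (fun x => Torus.convect w w x - ν • Torus.laplacian w x + Torus.gradient q x -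
          c • Torus.partialDeriv (2 : Fin 3) w x) ∧
        HasZeroMean (fun x => Torus.convect w w x - ν • Torus.laplacian w x + Torus.gradient q x -
          c • Torus.partialDeriv (2 : Fin 3) w x))
    (hF2 : ∀ (u v : 𝕋³ → E³), IsSmooth u → IsSmooth v →
      Real.sqrt (gradNormSq v) ≤ Real.sqrt (gradNormSq u) + Real.sqrt (gradNormSq (fun x => u x - v x)) ∧
      MeasureTheory.integral MeasureTheory.volume (fun x => ‖u x‖ ^ 2) ≤
        2 * MeasureTheory.integral MeasureTheory.volume (fun x => ‖v x‖ ^ 2) +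
          2 * MeasureTheory.integral MeasureTheory.volume (fun x => ‖u x - v x‖ ^ 2))
    (hD : DriftAbsorption)
    (hA : 0 < A) {C C₀ E ε₀ ν cc : ℝ} {K₀ : ℕ} (hC'' : 0 ≤ max C 0) (hCC'' : C ≤ max C 0)
    (_hA' : 0 < A * (1 + |C₀|) ^ k * (1 + max C 0) ^ k) (hC1 : 0 < max C 0 + 1) (hε₀ : 0 < ε₀)
    {f w : 𝕋³ → E³} {q : 𝕋³ → ℝ} (hf : IsSmooth f) (hfd : IsDivFree f) (hfm : HasZeroMean f)
    (hν : 0 < ν) (hν1 : ν ≤ 1)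
    (hν2 : ν < ((A * (1 + |C₀|) ^ k * (1 + max C 0) ^ k) ^ 4 * (max C 0 + 1))⁻¹)
    (hν3 : ν < ((A * (1 + |C₀|) ^ k * (1 + max C 0) ^ k) ^ 2 * (max C 0 + 1))⁻¹)
    (hν4 : ν < (ε₀ / (8 * (max C 0 + 1))) ^ 2) (hν5 : ν < ε₀ / 24)
    (hw : IsSmooth w) (hq : IsSmooth q) (hwd : IsDivFree w) (hwm : HasZeroMean w) (hcC : |cc| ≤ C)
    (hwE : MeasureTheory.integral MeasureTheory.volume (fun x => ‖w x‖ ^ 2) ≤ E)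
    (hdiss : |ν * gradNormSq w - ε₀| ≤ C * Real.sqrt ν)
    (hres : MeasureTheory.integral MeasureTheory.volume (fun x =>
        ‖Torus.convect w w x - ν • Torus.laplacian w x + Torus.gradient q x -
          cc • Torus.partialDeriv (2 : Fin 3) w x - f x‖ ^ 2) ≤ C * ν ^ (4 * (k * (K₀ + 1)) + 3))
    (hsup₀ : ∀ x, ‖w x‖ ≤ C) (hsup₁ : ∀ (i : Fin 3) x, ‖Torus.partialDeriv i w x‖ ≤ C * ν⁻¹)
    (hap : ∀ (v : 𝕋³ → E³) (r : 𝕋³ → ℝ) (b : ℝ), IsSmooth v → IsSmooth r → IsDivFree v → HasZeroMean v →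
      MeasureTheory.integral MeasureTheory.volume (fun x => ‖v x‖ ^ 2) + b ^ 2 ≤
        (C₀ * ν⁻¹ ^ K₀) ^ 2 * (MeasureTheory.integral MeasureTheory.volume (fun x =>
          ‖Torus.convect w v x + Torus.convect v w x - ν • Torus.laplacian v x + Torus.gradient r x -
            cc • Torus.partialDeriv (2 : Fin 3) v x - b • Torus.partialDeriv (2 : Fin 3) w x‖ ^ 2) +
          (MeasureTheory.integral MeasureTheory.volume (fun x =>
            inner ℝ (v x) (Torus.partialDeriv (2 : Fin 3) w x))) ^ 2)) :
    ∃ (u : 𝕋³ → E³) (p : 𝕋³ → ℝ),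
      IsClassicalNSSolutionOn Set.univ ν (fun _ => f) (fun _ => u) (fun _ => p) ∧
        MeasureTheory.integral MeasureTheory.volume (fun x => ‖u x‖ ^ 2) ≤ 2 * E + 2 + (max C 0 + 1) ^ 2 ∧
        ε₀ / 2 ≤ ν * gradNormSq u := by
  have hν0 : ν ≠ 0 := hν.ne'
  -- the exact force `f₀` of the quasi-steady state (smooth, mean zero) and the exact equation
  obtain ⟨hf₀s, hf₀m⟩ := hF1 ν w q cc hw hwd hq
  -- the bordered bound with `M = |C₀| ν^{-K₀}`
  have hM : 0 ≤ |C₀| * ν⁻¹ ^ K₀ := by positivity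
  have hBB : BorderedBound ν (|C₀| * ν⁻¹ ^ K₀) w cc := by
    intro v r b hv hr hvd hvm
    have h := hap v r b hv hr hvd hvm
    have hsq : (|C₀| * ν⁻¹ ^ K₀) ^ 2 = (C₀ * ν⁻¹ ^ K₀) ^ 2 := by rw [mul_pow, mul_pow, sq_abs]
    rw [hsq]
    exact h
  -- the persistence constant `P` and its power-counting bound `P ν^m ≤ A'`
  have hPpos : 0 < A * (1 + |C₀| * ν⁻¹ ^ K₀) ^ k * (1 + max C 0) ^ k * ν⁻¹ ^ k := by positivity
  have hPm : A * (1 + |C₀| * ν⁻¹ ^ K₀) ^ k * (1 + max C 0) ^ k * ν⁻¹ ^ k * ν ^ (k * (K₀ + 1)) ≤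
      A * (1 + |C₀|) ^ k * (1 + max C 0) ^ k :=
    persistenceConstant_mul_pow_le hA.le hC'' hν hν1
  have hPm0 : 0 ≤ A * (1 + |C₀| * ν⁻¹ ^ K₀) ^ k * (1 + max C 0) ^ k * ν⁻¹ ^ k * ν ^ (k * (K₀ + 1)) := by
    positivity
  -- abbreviations (plain `have`-level names via `generalize`-free `set`)
  set P : ℝ := A * (1 + |C₀| * ν⁻¹ ^ K₀) ^ k * (1 + max C 0) ^ k * ν⁻¹ ^ k with hP_def
  set A' : ℝ := A * (1 + |C₀|) ^ k * (1 + max C 0) ^ k with hA'_def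
  set m : ℕ := k * (K₀ + 1) with hm_def
  -- sup bounds with `C'' = max C 0`
  have hcC'' : |cc| ≤ max C 0 := le_trans hcC hCC''
  have hsup₀'' : ∀ x, ‖w x‖ ≤ max C 0 := fun x => le_trans (hsup₀ x) hCC''
  have hsup₁'' : ∀ (i : Fin 3) x, ‖Torus.partialDeriv i w x‖ ≤ max C 0 * ν⁻¹ := fun i x =>
    le_trans (hsup₁ i x) (mul_le_mul_of_nonneg_right hCC'' (inv_nonneg.2 hν.le))
  -- the residual, read as `‖f − f₀‖²`
  have hres' : MeasureTheory.integral MeasureTheory.volume (fun x => ‖f x -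
      (Torus.convect w w x - ν • Torus.laplacian w x + Torus.gradient q x -
        cc • Torus.partialDeriv (2 : Fin 3) w x)‖ ^ 2) ≤ C * ν ^ (4 * m + 3) := by
    have hcongr : (fun x => ‖f x - (Torus.convect w w x - ν • Torus.laplacian w x + Torus.gradient q x -
        cc • Torus.partialDeriv (2 : Fin 3) w x)‖ ^ 2) = fun x => ‖Torus.convect w w x -
          ν • Torus.laplacian w x + Torus.gradient q x - cc • Torus.partialDeriv (2 : Fin 3) w x -
          f x‖ ^ 2 := by
      funext x
      rw [norm_sub_rev]
    rw [hcongr]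
    exact hres
  -- power counting: `ν^K = ν³ (ν^m)^4`
  have hK4 : ν ^ (4 * m + 3) = ν ^ 3 * (ν ^ m) ^ 4 := by
    rw [← pow_mul, ← pow_add]; ring_nf
  have hν3' : ν ^ 3 ≤ ν := by
    have : ν ^ 3 ≤ ν ^ 1 := pow_le_pow_of_le_one hν.le hν1 (by norm_num)
    simpa using this
  have hν32 : ν ^ 3 ≤ ν ^ 2 := pow_le_pow_of_le_one hν.le hν1 (by norm_num)
  have hνm1 : (ν ^ m) ^ 2 ≤ 1 := pow_le_one₀ (by positivity) (pow_le_one₀ hν.le hν1)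
  have hPm4 : (P * ν ^ m) ^ 4 ≤ A' ^ 4 := pow_le_pow_left₀ hPm0 hPm 4
  have hPm2 : (P * ν ^ m) ^ 2 ≤ A' ^ 2 := pow_le_pow_left₀ hPm0 hPm 2
  -- (T1) the Kantorovich premise `C ν^K ≤ P⁻⁴`
  have hT1 : MeasureTheory.integral MeasureTheory.volume (fun x => ‖f x -
      (Torus.convect w w x - ν • Torus.laplacian w x + Torus.gradient q x -
        cc • Torus.partialDeriv (2 : Fin 3) w x)‖ ^ 2) ≤ (P ^ 4)⁻¹ := by
    have hkey : C * ν ^ (4 * m + 3) * P ^ 4 ≤ 1 := by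
      have h1 : C * ν ^ (4 * m + 3) * P ^ 4 = C * (ν ^ 3 * (P * ν ^ m) ^ 4) := by rw [hK4]; ring
      rw [h1]
      have h2 : C * (ν ^ 3 * (P * ν ^ m) ^ 4) ≤ max C 0 * (ν ^ 3 * (P * ν ^ m) ^ 4) :=
        mul_le_mul_of_nonneg_right hCC'' (by positivity)
      have h3 : max C 0 * (ν ^ 3 * (P * ν ^ m) ^ 4) ≤ max C 0 * (ν * A' ^ 4) :=
        mul_le_mul_of_nonneg_left (mul_le_mul hν3' hPm4 (by positivity) hν.le) hC''
      have h4 : max C 0 * (ν * A' ^ 4) ≤ (max C 0 + 1) * (ν * A' ^ 4) :=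
        mul_le_mul_of_nonneg_right (by linarith) (by positivity)
      have h5 : (max C 0 + 1) * (ν * A' ^ 4) < 1 := by
        have hpos : 0 < A' ^ 4 * (max C 0 + 1) := by positivity
        calc (max C 0 + 1) * (ν * A' ^ 4) = ν * (A' ^ 4 * (max C 0 + 1)) := by ring
          _ < (A' ^ 4 * (max C 0 + 1))⁻¹ * (A' ^ 4 * (max C 0 + 1)) :=
              mul_lt_mul_of_pos_right hν2 hpos
          _ = 1 := inv_mul_cancel₀ hpos.ne'
      linarith
    calc MeasureTheory.integral MeasureTheory.volume (fun x => ‖f x -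
          (Torus.convect w w x - ν • Torus.laplacian w x + Torus.gradient q x -
            cc • Torus.partialDeriv (2 : Fin 3) w x)‖ ^ 2)
        ≤ C * ν ^ (4 * m + 3) := hres'
      _ = C * ν ^ (4 * m + 3) * P ^ 4 * (P ^ 4)⁻¹ := by field_simp
      _ ≤ 1 * (P ^ 4)⁻¹ := mul_le_mul_of_nonneg_right hkey (by positivity)
      _ = (P ^ 4)⁻¹ := one_mul _
  -- apply C⁺ at the exact drifted steady state `(w, q, cc)` of the force `f₀`
  obtain ⟨u, p, c', hu, hp, hud, hum, hueq, hclose⟩ :=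
    hP ν (max C 0) (|C₀| * ν⁻¹ ^ K₀) (fun x => Torus.convect w w x - ν • Torus.laplacian w x +
        Torus.gradient q x - cc • Torus.partialDeriv (2 : Fin 3) w x) f w q cc hν hν1 hC'' hM hf₀s hf₀m hf hfd
      hfm hw hq hwd hwm hcC'' hsup₀'' hsup₁'' (fun x => rfl) hBB hT1
  -- (T2) closeness `≤ ν`
  have hT2 : MeasureTheory.integral MeasureTheory.volume (fun x => ‖u x - w x‖ ^ 2) +
      gradNormSq (fun x => u x - w x) + (c' - cc) ^ 2 ≤ ν := by
    refine le_trans hclose ?_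
    have h1 : P ^ 2 * MeasureTheory.integral MeasureTheory.volume (fun x => ‖f x -
        (Torus.convect w w x - ν • Torus.laplacian w x + Torus.gradient q x -
          cc • Torus.partialDeriv (2 : Fin 3) w x)‖ ^ 2) ≤ P ^ 2 * (C * ν ^ (4 * m + 3)) :=
      mul_le_mul_of_nonneg_left hres' (by positivity)
    refine le_trans h1 ?_
    have h2 : P ^ 2 * (C * ν ^ (4 * m + 3)) = C * (ν ^ 3 * (ν ^ m) ^ 2 * (P * ν ^ m) ^ 2) := by
      rw [hK4]; ring
    rw [h2]
    have h3 : C * (ν ^ 3 * (ν ^ m) ^ 2 * (P * ν ^ m) ^ 2) ≤ max C 0 * (ν ^ 3 * (ν ^ m) ^ 2 * (P * ν ^ m) ^ 2) :=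
      mul_le_mul_of_nonneg_right hCC'' (by positivity)
    have h4 : max C 0 * (ν ^ 3 * (ν ^ m) ^ 2 * (P * ν ^ m) ^ 2) ≤ max C 0 * (ν ^ 2 * 1 * A' ^ 2) :=
      mul_le_mul_of_nonneg_left (mul_le_mul (mul_le_mul hν32 hνm1 (by positivity) (by positivity)) hPm2
        (by positivity) (by positivity)) hC''
    have h5 : max C 0 * (ν ^ 2 * 1 * A' ^ 2) ≤ ν * (ν * (A' ^ 2 * (max C 0 + 1))) := by
      have e : max C 0 * (ν ^ 2 * 1 * A' ^ 2) = ν * (ν * (A' ^ 2 * max C 0)) := by ring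
      rw [e]
      have e2 : A' ^ 2 * max C 0 ≤ A' ^ 2 * (max C 0 + 1) :=
        mul_le_mul_of_nonneg_left (by linarith) (by positivity)
      exact mul_le_mul_of_nonneg_left (mul_le_mul_of_nonneg_left e2 hν.le) hν.le
    have h6 : ν * (A' ^ 2 * (max C 0 + 1)) < 1 := by
      have hpos : 0 < A' ^ 2 * (max C 0 + 1) := by positivity
      calc ν * (A' ^ 2 * (max C 0 + 1)) < (A' ^ 2 * (max C 0 + 1))⁻¹ * (A' ^ 2 * (max C 0 + 1)) :=
            mul_lt_mul_of_pos_right hν3 hpos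
        _ = 1 := inv_mul_cancel₀ hpos.ne'
    have h7 : ν * (ν * (A' ^ 2 * (max C 0 + 1))) ≤ ν * 1 := mul_le_mul_of_nonneg_left h6.le hν.le
    linarith
  -- drift absorption
  obtain ⟨hsol, hgrad, hen⟩ := hD ν f u p c' hu hp hud hum hueq
  have hI0 : 0 ≤ MeasureTheory.integral MeasureTheory.volume (fun x => ‖u x - w x‖ ^ 2) :=
    MeasureTheory.integral_nonneg fun _ => sq_nonneg _
  have hg0 : 0 ≤ gradNormSq (fun x => u x - w x) := gradNormSq_nonneg _
  have hsq0 : 0 ≤ (c' - cc) ^ 2 := sq_nonneg _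
  refine ⟨fun x => u x - c' • EuclideanSpace.single (2 : Fin 3) (1 : ℝ), p, hsol, ?_, ?_⟩
  · -- energy
    have hE1 : MeasureTheory.integral MeasureTheory.volume (fun x => ‖u x - w x‖ ^ 2) ≤ 1 := by linarith
    have hcc : (c' - cc) ^ 2 ≤ 1 := by linarith
    have hc'1 : |c'| ≤ max C 0 + 1 := by
      have h1 : |c' - cc| ≤ 1 := by
        have h := Real.sqrt_le_sqrt hcc
        rwa [Real.sqrt_sq_eq_abs, Real.sqrt_one] at h
      have h2 := abs_sub_abs_le_abs_sub c' cc
      linarith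
    have hc'2 : c' ^ 2 ≤ (max C 0 + 1) ^ 2 := by
      refine sq_le_sq.2 ?_
      rw [abs_of_nonneg (by positivity : (0 : ℝ) ≤ max C 0 + 1)]
      exact hc'1
    obtain ⟨-, hsplit⟩ := hF2 u w hu hw
    rw [hen]
    linarith
  · -- dissipation: `‖∇w‖ ≤ ‖∇u‖ + ‖∇(u − w)‖`, `‖∇(u−w)‖² ≤ ν`
    rw [hgrad]
    obtain ⟨hMink, -⟩ := hF2 u w hu hw
    have hgu : 0 ≤ gradNormSq u := gradNormSq_nonneg _
    have hgw : 0 ≤ gradNormSq w := gradNormSq_nonneg _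
    have hguw : gradNormSq (fun x => u x - w x) ≤ ν := by linarith
    have ha0 : 0 ≤ Real.sqrt (gradNormSq u) := Real.sqrt_nonneg _
    have hb0 : 0 ≤ Real.sqrt (gradNormSq (fun x => u x - w x)) := Real.sqrt_nonneg _
    have hs0 : 0 ≤ Real.sqrt (gradNormSq w) := Real.sqrt_nonneg _
    have ha2 : Real.sqrt (gradNormSq u) ^ 2 = gradNormSq u := Real.sq_sqrt hgu
    have hs2 : Real.sqrt (gradNormSq w) ^ 2 = gradNormSq w := Real.sq_sqrt hgw
    have hb2 : Real.sqrt (gradNormSq (fun x => u x - w x)) ^ 2 ≤ ν := by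
      rw [Real.sq_sqrt hg0]; exact hguw
    -- `s² ≤ (a+b)² ≤ (3/2)a² + 3b²`
    have hsq1 : Real.sqrt (gradNormSq w) ^ 2 ≤
        (Real.sqrt (gradNormSq u) + Real.sqrt (gradNormSq (fun x => u x - w x))) ^ 2 :=
      pow_le_pow_left₀ hs0 hMink 2
    have hsq2 : (Real.sqrt (gradNormSq u) + Real.sqrt (gradNormSq (fun x => u x - w x))) ^ 2 ≤
        (3 / 2) * Real.sqrt (gradNormSq u) ^ 2 + 3 * Real.sqrt (gradNormSq (fun x => u x - w x)) ^ 2 := by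
      nlinarith [sq_nonneg (Real.sqrt (gradNormSq u) - 2 * Real.sqrt (gradNormSq (fun x => u x - w x)))]
    have hmain : gradNormSq w ≤ (3 / 2) * gradNormSq u + 3 * ν := by
      rw [← hs2, ← ha2]; linarith
    -- thresholds for the dissipation arithmetic
    have hsqν0 : 0 ≤ Real.sqrt ν := Real.sqrt_nonneg _
    have hsmall : Real.sqrt ν < ε₀ / (8 * (max C 0 + 1)) := by
      calc Real.sqrt ν < Real.sqrt ((ε₀ / (8 * (max C 0 + 1))) ^ 2) := Real.sqrt_lt_sqrt hν.le hν4
        _ = ε₀ / (8 * (max C 0 + 1)) := Real.sqrt_sq (by positivity)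
    have h4 : (max C 0 + 1) * Real.sqrt ν < ε₀ / 8 := by
      calc (max C 0 + 1) * Real.sqrt ν < (max C 0 + 1) * (ε₀ / (8 * (max C 0 + 1))) :=
            mul_lt_mul_of_pos_left hsmall hC1
        _ = ε₀ / 8 := by field_simp
    have h5 : C * Real.sqrt ν ≤ (max C 0 + 1) * Real.sqrt ν :=
      mul_le_mul_of_nonneg_right (by linarith) hsqν0
    have hνsq : ν ^ 2 ≤ ν := by nlinarith
    have hd1 := abs_le.1 hdiss
    have hνgw : ε₀ - C * Real.sqrt ν ≤ ν * gradNormSq w := by linarith [hd1.1, hd1.2]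
    have hνmain : ν * gradNormSq w ≤ (3 / 2) * (ν * gradNormSq u) + 3 * ν ^ 2 := by
      have h := mul_le_mul_of_nonneg_left hmain hν.le
      have e : ν * ((3 / 2) * gradNormSq u + 3 * ν) = (3 / 2) * (ν * gradNormSq u) + 3 * ν ^ 2 := by ring
      linarith
    linarith

set_option maxHeartbeats 1600000 in
/-- **THE FORCE-SIDE COMPOSITION (kernel-checked).**  `QuantBorderedPersistence` (C⁺) + `CalculusFacts` + `DriftAbsorption`
imply the crux `Theses.NeutralTaylorWaves.NewtonRealisation` BY NAME.  Proof: destructure `NonresonantTaylorWaves`; take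
`(k, A)` from C⁺, `m := k(K₀+1)`, `K := 4m + 3`, `C := C_K`, `C'' := max C 0`, `A' := A(1+|C₀|)^k(1+C'')^k`; thresholds
`ν < 1`, `ν < (A'^4(C''+1))⁻¹` (Kantorovich premise `C_Kν^K ≤ P⁻⁴`), `ν < (A'^2(C''+1))⁻¹` (closeness `P²C_Kν^K ≤ ν`),
`ν < (ε₀/(8(C''+1)))²` and `ν < ε₀/24` (dissipation); per selected `n`: the quasi-steady `(w, q, c)` is an EXACT drifted steady
state of `f₀ := w·∇w − νΔw + ∇q − c∂₃w` (by `rfl`), `∫‖f − f₀‖² = residual ≤ C_Kν^K`, C⁺ realises `f`, drift absorption gives the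
classical solution `u − c'e₃`; energy `≤ 2E + 2 + (C''+1)²`, dissipation `≥ ε₀/2` (Minkowski + AM–GM: `‖∇w‖² ≤ (3/2)‖∇u‖² + 3ν`). -/
theorem NewtonRealisation_of_quantPersistence (hP : QuantBorderedPersistence) (hF : CalculusFacts)
    (hD : DriftAbsorption) :
    Summit.AnomalousDissipation.AnomalousDissipation.Theses.NeutralTaylorWaves.NewtonRealisation := by
  unfold Summit.AnomalousDissipation.AnomalousDissipation.Theses.NeutralTaylorWaves.NewtonRealisation
  intro hX
  unfold Summit.AnomalousDissipation.AnomalousDissipation.Theses.NeutralTaylorWaves.NonresonantTaylorWaves at hX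
  obtain ⟨f, hf, hfd, hfm, ν, E, ε₀, C₀, K₀, hνpos, hνlim, hε₀, hX⟩ := hX
  obtain ⟨k, A, hA, hP⟩ := hP
  obtain ⟨hF1, hF2⟩ := hF
  -- the order `K` and the constants
  obtain ⟨C, hX⟩ := hX (4 * (k * (K₀ + 1)) + 3)
  have hC'' : 0 ≤ max C 0 := le_max_right _ _
  have hCC'' : C ≤ max C 0 := le_max_left _ _
  have hA' : 0 < A * (1 + |C₀|) ^ k * (1 + max C 0) ^ k := by positivity
  have hC1 : 0 < max C 0 + 1 := by linarith
  -- the viscosity threshold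
  obtain ⟨δ, hδpos, hδ1, hδ2, hδ3, hδ4, hδ5⟩ : ∃ δ : ℝ, 0 < δ ∧ δ ≤ 1 ∧
      δ ≤ ((A * (1 + |C₀|) ^ k * (1 + max C 0) ^ k) ^ 4 * (max C 0 + 1))⁻¹ ∧
      δ ≤ ((A * (1 + |C₀|) ^ k * (1 + max C 0) ^ k) ^ 2 * (max C 0 + 1))⁻¹ ∧
      δ ≤ (ε₀ / (8 * (max C 0 + 1))) ^ 2 ∧ δ ≤ ε₀ / 24 := by
    refine ⟨min (min (min 1 ((A * (1 + |C₀|) ^ k * (1 + max C 0) ^ k) ^ 4 * (max C 0 + 1))⁻¹)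
      (min ((A * (1 + |C₀|) ^ k * (1 + max C 0) ^ k) ^ 2 * (max C 0 + 1))⁻¹ ((ε₀ / (8 * (max C 0 + 1))) ^ 2)))
      (ε₀ / 24), ?_, ?_, ?_, ?_, ?_, ?_⟩
    · exact lt_min (lt_min (lt_min one_pos (by positivity)) (lt_min (by positivity) (by positivity))) (by positivity)
    · exact le_trans (min_le_left _ _) (le_trans (min_le_left _ _) (min_le_left _ _))
    · exact le_trans (min_le_left _ _) (le_trans (min_le_left _ _) (min_le_right _ _))
    · exact le_trans (min_le_left _ _) (le_trans (min_le_right _ _) (min_le_left _ _))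
    · exact le_trans (min_le_left _ _) (le_trans (min_le_right _ _) (min_le_right _ _))
    · exact min_le_right _ _
  obtain ⟨N₁, hN₁⟩ : ∃ N₁ : ℕ, ∀ n', N₁ ≤ n' → ν n' < δ :=
    Filter.eventually_atTop.1 ((tendsto_order.1 hνlim).2 δ hδpos)
  -- the nonresonant subsequence beyond the threshold, with its certified quasi-steady states
  choose n hn w q c hw hq hwd hwm hcC hwE hdiss hres hsup₀ hsup₁ hsup₂ hap using
    fun j : ℕ => hX (max N₁ j)
  have hjn : ∀ j, j ≤ n j := fun j => le_trans (le_max_right _ _) (hn j)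
  have hnδ : ∀ j, ν (n j) < δ := fun j => hN₁ _ (le_trans (le_max_left _ _) (hn j))
  -- realisation at each `j`
  have hreal : ∀ j : ℕ, ∃ (u : 𝕋³ → E³) (p : 𝕋³ → ℝ),
      IsClassicalNSSolutionOn Set.univ (ν (n j)) (fun _ => f) (fun _ => u) (fun _ => p) ∧
        MeasureTheory.integral MeasureTheory.volume (fun x => ‖u x‖ ^ 2) ≤ 2 * E + 2 + (max C 0 + 1) ^ 2 ∧
        ε₀ / 2 ≤ ν (n j) * gradNormSq u :=
    fun j => perStep hP hF1 hF2 hD hA hC'' hCC'' hA' hC1 hε₀ hf hfd hfm (hνpos (n j))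
      (le_trans (hnδ j).le hδ1) (lt_of_lt_of_le (hnδ j) hδ2) (lt_of_lt_of_le (hnδ j) hδ3)
      (lt_of_lt_of_le (hnδ j) hδ4) (lt_of_lt_of_le (hnδ j) hδ5) (hw j) (hq j) (hwd j) (hwm j) (hcC j) (hwE j)
      (hdiss j) (hres j) (hsup₀ j) (hsup₁ j) (hap j)
  choose u p hsol hEn hDis using hreal
  refine ⟨f, hf, hfd, hfm, fun j => ν (n j), u, p, fun j => hνpos (n j), ?_, hsol,
    ⟨2 * E + 2 + (max C 0 + 1) ^ 2, hEn⟩, ε₀ / 2, half_pos hε₀, hDis⟩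
  exact hνlim.comp (tendsto_atTop_mono hjn tendsto_id)

end Summit.AnomalousDissipation.AnomalousDissipation.Cruxes.NewtonRealisation.Ideator1

end
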